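import Summits.BirchSwinnertonDyer.BirchSwinnertonDyer.Theorems.TameQuarticManinParityTprimeIrrModThreeSaturationOfLeaves
import Summits.BirchSwinnertonDyer.BirchSwinnertonDyer.Theorems.TameQuarticManinParityPrymDefectUnconditional
import HarnessLib

/-!
# Crux MS `TprimeIrrModThreeSaturation` (stmt-BirchSwinnertonDyer-23367) modulo the THREE Galois-side named facts only
# (lead `cruxlead-stmt-BirchSwinnertonDyer-23367` g3, line `abelian-fixed-points`)

Knapp's Prop. 11.22 — the fourth hypothesis `hK` of the g2 closure `tprimeIrrModThreeSaturation_of_namedFacts` (p685633) —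
is now the theorem `periodFunctional_ker_le_ellipticParabolic_sup_commutator_holds`; the H2 branch of the organ is proved
outright (`tprimeIrrPrymDefectAvoidsThree_proof`).  What remains under MS is the H1 branch's Galois half:
* `tprimeIrrNormImageAvoidsThree_of_galoisFacts` : (E) ∧ (D) ∧ (61) ⇒ H1 `TprimeIrrNormImageAvoidsThree` (stmt-23479), via
  L31 ⇐ (E, D, 61) (`levelThirdAvoidsThree_of_namedFacts`) and H1 ⇐ L31 (`normImageAvoidsThree_of_levelThird`);
* `tprimeIrrFixedPartAvoidsThree_of_galoisFacts` : (E) ∧ (D) ∧ (61) ⇒ A29 `TprimeIrrFixedPartAvoidsThree` (stmt-23478);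
* `tprimeIrrModThreeSaturation_of_galoisFacts` : (E) ∧ (D) ∧ (61) ⇒ MS,
where (E) = `edixhoven1992_serreWeight_le_weight_of_newform` (Edixhoven 1992 Thm. 4.5), (D) =
`darmonDiamondTaylor1995_ordinary_of_weightTwo_newform_dvd_level` (DDT95 Thm. 3.1(g)), (61) =
`DeligneSerre1974.thm61_exists_adicGaloisRep` (Deligne 1971 / Deligne–Serre 1974 Thm. 6.1).  CONDITIONAL RESULTS; the items
stay open.  THEOREMS ONLY.  No multiplicity one anywhere.  No summit is proved; BSD is NOT proved.
-/

set_option autoImplicit false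
-- D-0017: single-problem summit, so `Summit.BirchSwinnertonDyer.BirchSwinnertonDyer.…` repeats a namespace BY DESIGN.
set_option linter.dupNamespace false

noncomputable section

namespace Summit.BirchSwinnertonDyer.BirchSwinnertonDyer.Theorems.TameQuarticManinParity

open Summit.BirchSwinnertonDyer.BirchSwinnertonDyer.Theses.TameQuarticManinParity

/-- **H1 `TprimeIrrNormImageAvoidsThree` (stmt-BirchSwinnertonDyer-23479) modulo the three Galois-side named facts**:
L31 ⇐ (E, D, 61) (`levelThirdAvoidsThree_of_namedFacts`, p685633) and H1 ⇐ L31 (`normImageAvoidsThree_of_levelThird`, p679768).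
CONDITIONAL RESULT. [cite: Edixhoven1992, Thm. 4.5] [cite: DarmonDiamondTaylor1995, Thm. 3.1 (g) (p. 86)]
[cite: DeligneSerreASENS1974, Thm. 6.1] -/
theorem tprimeIrrNormImageAvoidsThree_of_galoisFacts
    (hE : Literature.NumberTheory.Automorphic.edixhoven1992_serreWeight_le_weight_of_newform)
    (hD : Literature.NumberTheory.Automorphic.darmonDiamondTaylor1995_ordinary_of_weightTwo_newform_dvd_level)
    (h61 : Literature.NumberTheory.EllipticCurves.ModularForms.DeligneSerre1974.thm61_exists_adicGaloisRep) :
    TprimeIrrNormImageAvoidsThree :=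
  normImageAvoidsThree_of_levelThird (levelThirdAvoidsThree_of_namedFacts hE hD h61)

/-- **A29 `TprimeIrrFixedPartAvoidsThree` (stmt-BirchSwinnertonDyer-23478) modulo the three Galois-side named facts**:
A29 ⇐ H1 ∧ H2 (`fixedPartAvoidsThree_of_normImage_of_prymDefect`, p673284) with H2 PROVED (`tprimeIrrPrymDefectAvoidsThree_proof`).
CONDITIONAL RESULT. [cite: Edixhoven1992, Thm. 4.5] [cite: DarmonDiamondTaylor1995, Thm. 3.1 (g) (p. 86)]
[cite: DeligneSerreASENS1974, Thm. 6.1] -/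
theorem tprimeIrrFixedPartAvoidsThree_of_galoisFacts
    (hE : Literature.NumberTheory.Automorphic.edixhoven1992_serreWeight_le_weight_of_newform)
    (hD : Literature.NumberTheory.Automorphic.darmonDiamondTaylor1995_ordinary_of_weightTwo_newform_dvd_level)
    (h61 : Literature.NumberTheory.EllipticCurves.ModularForms.DeligneSerre1974.thm61_exists_adicGaloisRep) :
    TprimeIrrFixedPartAvoidsThree :=
  fixedPartAvoidsThree_of_normImage_of_prymDefect (tprimeIrrNormImageAvoidsThree_of_galoisFacts hE hD h61)
    tprimeIrrPrymDefectAvoidsThree_proof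

/-- **The crux MS `TprimeIrrModThreeSaturation` (stmt-BirchSwinnertonDyer-23367) modulo exactly THREE catalogued named
facts** — (E) Edixhoven 1992 Thm. 4.5, (D) Darmon–Diamond–Taylor 1995 Thm. 3.1(g), (61) Deligne–Serre 1974 Thm. 6.1 — every
other input of the line `abelian-fixed-points` (Knapp 11.22, E32a, E32b, E30, B30, H2, W23b, LIFT33, FIN34a/b, X35, RIG35 and
all glue) being a landed theorem.  CONDITIONAL RESULT. [cite: Edixhoven1992, Thm. 4.5]
[cite: DarmonDiamondTaylor1995, Thm. 3.1 (g) (p. 86)] [cite: DeligneSerreASENS1974, Thm. 6.1] -/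
theorem tprimeIrrModThreeSaturation_of_galoisFacts
    (hE : Literature.NumberTheory.Automorphic.edixhoven1992_serreWeight_le_weight_of_newform)
    (hD : Literature.NumberTheory.Automorphic.darmonDiamondTaylor1995_ordinary_of_weightTwo_newform_dvd_level)
    (h61 : Literature.NumberTheory.EllipticCurves.ModularForms.DeligneSerre1974.thm61_exists_adicGaloisRep) :
    TprimeIrrModThreeSaturation :=
  modThreeSaturation_of_fixedPartAvoidsThree (tprimeIrrFixedPartAvoidsThree_of_galoisFacts hE hD h61)

end Summit.BirchSwinnertonDyer.BirchSwinnertonDyer.Theorems.TameQuarticManinParity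

end
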